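import Summits.HodgeConjecture.HodgeConjecture.Theorems.F0LD2SoftRoadBricks
import Literature.NumberTheory.GelbartRogawski1991.LocalDoubledTwistedSectionEigenlaw
import Literature.NumberTheory.GelbartRogawski1991.LocalDoubledLeraySectionSiegelUnipotent
import Literature.NumberTheory.GelbartRogawski1991.LocalSchrodingerWeylFourierTwin
import Literature.RepresentationTheory.MoeglinVignerasWaldspurger1987.SBInvariantFunctionalVanishesOfConjugateModel
import HarnessLib

/-!
# Crux `HLiu418`, line LD2, soft road (π3): (Z-van) «every `U(W ⊕ −W)`-invariant functional on `𝒮(L⁺_v^{2+2})` vanishes» FROM THE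
# OPERATOR WORDS of the Siegel unipotents and of the Weyl element in a conjugate model — the mover-agnostic junction

Cell `hodgecm-mathlib` (D-0151), half A line LD2 (crux hLiu418 = `stmt-HodgeConjecture-24832`; organ `LineThetaTypesComplementary₁`; soft-road junction
bricks ★ `Theorems/F0LD2SoftRoadBricks.lean` (A-p13 (g40)), cut (Z) ⟸ (Z-Λ) ∧ (Z-van) of B-p04 (g45)'s `Theorems/F0LD2SoftRoadZBricks.lean` (review lane at
the time of writing; its `def ZVan` is spelled out VERBATIM below, so the junction's `stub_zVan` closes by `δ`-unfolding once both are in the tree)).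
Seat A-p19 (g31), LD2-plan (g3) DEALS #16 (2) ∕ #17 (1); `--supports stmt-HodgeConjecture-24832`.  KERNEL ONLY: one theorem, no definition, no named
fact, no instance, no notation, no `sorry`.

THE STATEMENT `zVan_of_operatorWords : (OPW) → ‹ZVan›`.  ‹ZVan› (B-p04 (g45), rf b8bc1d406bbef246 :98–:129): for a CM field `L`, a non-split `v`
(`hE`), Haar `μ`, an ANISOTROPIC real plane `T = T₁ ⊕ᶠ αT₁` (`(−α⁻¹, δ²)_v = −1`), a splitting character `χ`, and the standard doubled line
`G₁ = U(⟨1⟩ ⊕ ⟨−1⟩)(L⁺_v) = localPi L c̄ (1+1) JD₁ v`: every linear functional `Λ` on `𝒮(L⁺_v^{2+2})` with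
`Λ (μ_v(det g)⁻¹ • ω^𝔻(s^𝔻(ι g)) Ψ) = Λ Ψ` for all `g ∈ G₁` (`ι = kronLoc … 2`, `s^𝔻` = Kudla's CM splitting of the doubled plane, `ω^𝔻 = toRep` of
its Schrödinger model) is ZERO.  (OPW) «OPERATOR WORDS» — the SAME binder prefix, concluding: there are an implementer `Γ : 𝒮 ≃ₗ 𝒮` (of a mover
`E″` of `ℓ_Δ` onto `ℓ_Y`), a matrix `c₀` with `halfForm (c₀ ·)` ANISOTROPIC, a family `n : L⁺_v → G₁` and an element `w ∈ G₁`, a linear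
automorphism `A` of `𝒮` whose inverse reads the value at `0` (`(A⁻¹ g)(0) = κ g(0)`), `γ ∈ ℂ` and a conductor exponent `m` of `ψ_v`, such that
(GRP-N)+(J1a) `σ(n b) Ψ = Γ⁻¹ (unipOpPi (b • c₀ ·) (Γ Ψ))` and (GRP-W)+(J1b) `σ(w) Ψ = γ • Γ⁻¹ (𝓕 (A (Γ Ψ)))` for the twisted section `σ` above
(`𝓕 = fourierOpPi μ ψ_v m`).  PROOF: ★ `functional_eq_zero_of_invariant_of_conjugate_model_fourierOp` (A-p19 (g31), p850994 ∕ ED. 2) at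
`V := 𝒮(L⁺_v^{2+2})`, `σ := g ↦ μ_v(det g)⁻¹ • ω^𝔻(s^𝔻(ι g))`.

WHO DISCHARGES (OPW) (the closer `operatorWords_holds`, ≈ 30 lines, mine when the inputs are ★): `Γ` := an implementer of LD2-p01 (g3)'s ADAPTED
mover `E″` (DEALS #17 (1) «= (α)»); `c₀ := cOfFix 𝕋 (E″ ι_D(n_Δ(t₀)) E″⁻¹)` with LD2-p02 (g3)'s (GRP-N) `mover_conj_iotaD_nElem_eq_transportSp_low` ∕
`cOfFix_smul` ∕ `halfForm_cOfFix_eq_zero_iff` + A-p13 (g40)'s (AN-core) + ★ (J1a) `leraySection_deltaLagrangian_apply_eq_conj_unipOpPi` + ★ `kronLoc_nElem`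
(`β = 1`, `μ_v(det n) = 1` on `N_Δ`); `w := w_Δ¹` with ★ `kronLoc_weylDelta` + LD2-p01's (GRP-W) `E″ ι_D(w_Δ) E″⁻¹ = J⁻¹ · m(B)` + ★ (J1b)
`leraySection_deltaLagrangian_apply_eq_smul_conj_fourierOpPi_leviOpPi` (its `∃ γ : ℂˣ`), `A := leviOpPi (glEquiv B)` (`κ` by ★ `coe_leviOpPi_apply`).
HONEST LABEL: nothing of print is asserted; (OPW) stays a hypothesis.  HC_CM is proved only modulo the 7 printed citations (2 remaining: hLiu418 =
stmt-HodgeConjecture-24832, h413 = stmt-HodgeConjecture-24833) until rung 0 closes; count-neutral.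

## References
* [MoeglinVignerasWaldspurger1987] C. Mœglin, M.-F. Vignéras, J.-L. Waldspurger, LNM 1291 (1987), Chap. 2 II.1–II.2 (Schrödinger models of two
  polarisations, the Weyl element as Fourier transform, Siegel unipotents as second-degree characters), Chap. 3 §IV.4 (rank-one dichotomy).
* [Kudla1994] S. S. Kudla, Israel J. Math. 87 (1994), §3 Thm. 3.1 (the splitting on the Siegel parabolic).
* [HarrisKudlaSweet1996] M. Harris, S. S. Kudla, W. J. Sweet, J. AMS 9 (1996), §6 Thm. 6.1.
* [GelbartRogawski1991] S. Gelbart, J. Rogawski, Invent. Math. 105 (1991), §3.2 (3.2.2)–(3.2.4) p. 457.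
-/

set_option autoImplicit false
set_option linter.dupNamespace false

noncomputable section

open scoped Matrix Kronecker
open NumberField IsDedekindDomain MeasureTheory MeasureTheory.Measure
open Literature.NumberTheory Literature.NumberTheory.Automorphic Literature.NumberTheory.Automorphic.UnitaryGroup
open Literature.RepresentationTheory Literature.RepresentationTheory.HeisenbergGroup Literature.RepresentationTheory.TwistedCoinv
open Literature.NumberTheory.GelbartRogawski1991 Literature.NumberTheory.GelbartRogawski1991.UnitaryDualPair
open Literature.NumberTheory.GelbartRogawski1991.UnitaryDualPair.WeilCoinv
open Literature.NumberTheory.GelbartRogawski1991.UnitaryDualPair.LocalSplitting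
open Literature.NumberTheory.GelbartRogawski1991.GRConstruction
open Literature.NumberTheory.Weil1964
open Literature.NumberTheory.GaloisRepresentations Literature.RepresentationTheory.HarrisKudlaSweet1996
open Literature.RepresentationTheory.MoeglinVignerasWaldspurger1987
open Literature.NumberTheory.QuadraticForms

namespace Summit.HodgeConjecture.HodgeConjecture.Cruxes.HLiu418.F0LD2SoftRoadJunction

set_option synthInstance.maxHeartbeats 400000 in
set_option maxHeartbeats 4000000 in -- the doubled CM datum's telescope
/-- **(Z-van) FROM THE OPERATOR WORDS** (mover-agnostic junction): if, over the binder prefix of ‹ZVan›, some implementer `Γ` conjugates the twisted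
doubled Weil section `σ(g) = μ_v(det g)⁻¹ • ω^𝔻(s^𝔻(ι g))` of the standard doubled line at the Siegel unipotents `n b` into the second-degree operators
`unipOpPi (b • c₀ ·)` of an ANISOTROPIC `c₀`, and at a Weyl element `w` into `γ • 𝓕 ∘ A` with `A` a linear automorphism whose inverse reads the value at
`0`, then every `σ`-invariant linear functional on `𝒮(L⁺_v^{2+2})` is `0` — ‹ZVan› verbatim (★ `functional_eq_zero_of_invariant_of_conjugate_model_fourierOp`).
[cite: MoeglinVignerasWaldspurger1987, Chap. 2 II.1–II.2; Chap. 3 §IV.4] [cite: Kudla1994, §3 Thm. 3.1] [cite: HarrisKudlaSweet1996, §6 Thm. 6.1] -/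
theorem zVan_of_operatorWords
    (hOW :     ∀ (L : Type) [Field L] [NumberField L] [IsCMField L] (v : HeightOneSpectrum (𝓞 (maximalRealSubfield L)))
      [MeasurableSpace (v.adicCompletion (maximalRealSubfield L))] [BorelSpace (v.adicCompletion (maximalRealSubfield L))]
      (μ : Measure (v.adicCompletion (maximalRealSubfield L))) [μ.IsAddHaarMeasure]
      (hE : IsField (UnitaryGroup.LocalRing L v))
      {T₁ T₂ : Matrix (Fin 1) (Fin 1) (maximalRealSubfield L)} (hT₁ : T₁.IsSymm) (hT₂ : T₂.IsSymm) (hT₁d : IsUnit T₁.det) (hT₂d : IsUnit T₂.det)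
      (α : (maximalRealSubfield L)ˣ) (hTT' : T₂ = (α : maximalRealSubfield L) • T₁)
      (hclass : hilbertSymbol (v.adicCompletion (maximalRealSubfield L))
        ((-(α : maximalRealSubfield L)⁻¹ : maximalRealSubfield L) : v.adicCompletion (maximalRealSubfield L))
        ((imagUnitSq L : maximalRealSubfield L) : v.adicCompletion (maximalRealSubfield L)) = -1)
      {T : Matrix (Fin (1 + 1)) (Fin (1 + 1)) (maximalRealSubfield L)} (hT : T = UnitaryGroup.finSum 1 1 T₁ T₂) (hTs : T.IsSymm) (hTd : IsUnit T.det)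
      (χ : HeckeCharacter L) (hχ : IsSplittingChar L 1 χ)
      {JD₁ : Matrix (Fin (1 + 1)) (Fin (1 + 1)) L}
      (hJD₁ : JD₁ = (gramD (maximalRealSubfield L) 1 1).map (algebraMap (maximalRealSubfield L) L)),
        ∃ (Γ : SchwartzBruhat (Fin (2 + 2) → v.adicCompletion (maximalRealSubfield L)) ≃ₗ[ℂ]
            SchwartzBruhat (Fin (2 + 2) → v.adicCompletion (maximalRealSubfield L)))
          (c₀ : Matrix (Fin (2 + 2)) (Fin (2 + 2)) (v.adicCompletion (maximalRealSubfield L)))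
          (n : v.adicCompletion (maximalRealSubfield L) → UnitaryGroup.localPi L (IsCMField.complexConj L) (1 + 1) JD₁ v)
          (w : UnitaryGroup.localPi L (IsCMField.complexConj L) (1 + 1) JD₁ v)
          (A : SchwartzBruhat (Fin (2 + 2) → v.adicCompletion (maximalRealSubfield L)) ≃ₗ[ℂ]
            SchwartzBruhat (Fin (2 + 2) → v.adicCompletion (maximalRealSubfield L)))
          (κ γ : ℂ) (m : ℤ) (hm : (adeleAddCharAt (maximalRealSubfield L) v).HasConductorExp m),
          (∀ x : Fin (2 + 2) → v.adicCompletion (maximalRealSubfield L), halfForm (Matrix.mulVecLin c₀) x = 0 → x = 0) ∧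
          (∀ (b : v.adicCompletion (maximalRealSubfield L)) (Ψ : SchwartzBruhat (Fin (2 + 2) → v.adicCompletion (maximalRealSubfield L))),
            (((localMu L χ v (Matrix.GeneralLinearGroup.det ((localPiEquiv L (IsCMField.complexConj L) (1 + 1) JD₁ v (n b)).1)))⁻¹ : ℂˣ) : ℂ) •
            MpPsi.toRep (localSchrodinger (maximalRealSubfield L) (2 + 2) (gramD (maximalRealSubfield L) 2 T) v)
              ((localSplittingDatumCM L v μ 2 hTs hTd rfl χ hχ).localSplitting
                (kronLoc (maximalRealSubfield L) L (IsCMField.complexConj L) v 2 (T := T) (J := T.map (algebraMap (maximalRealSubfield L) L))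
                  rfl rfl hJD₁ (n b))) Ψ =
              Γ.symm (unipOpPi (isLocallyConstant_of_isContinuousNontrivial (isContinuousNontrivial_adeleAddCharAt (maximalRealSubfield L) v))
                (b • Matrix.mulVecLin c₀) (Γ Ψ))) ∧
          (∀ g : SchwartzBruhat (Fin (2 + 2) → v.adicCompletion (maximalRealSubfield L)),
            ((A.symm g : SchwartzBruhat (Fin (2 + 2) → v.adicCompletion (maximalRealSubfield L))) :
                (Fin (2 + 2) → v.adicCompletion (maximalRealSubfield L)) → ℂ) 0 =
              κ * (g : (Fin (2 + 2) → v.adicCompletion (maximalRealSubfield L)) → ℂ) 0) ∧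
          (∀ Ψ : SchwartzBruhat (Fin (2 + 2) → v.adicCompletion (maximalRealSubfield L)),
            (((localMu L χ v (Matrix.GeneralLinearGroup.det ((localPiEquiv L (IsCMField.complexConj L) (1 + 1) JD₁ v w).1)))⁻¹ : ℂˣ) : ℂ) •
            MpPsi.toRep (localSchrodinger (maximalRealSubfield L) (2 + 2) (gramD (maximalRealSubfield L) 2 T) v)
              ((localSplittingDatumCM L v μ 2 hTs hTd rfl χ hχ).localSplitting
                (kronLoc (maximalRealSubfield L) L (IsCMField.complexConj L) v 2 (T := T) (J := T.map (algebraMap (maximalRealSubfield L) L))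
                  rfl rfl hJD₁ w)) Ψ =
              γ • Γ.symm (fourierOpPi μ (isContinuousNontrivial_adeleAddCharAt (maximalRealSubfield L) v) hm (A (Γ Ψ))))) :
    ∀ (L : Type) [Field L] [NumberField L] [IsCMField L] (v : HeightOneSpectrum (𝓞 (maximalRealSubfield L)))
    [MeasurableSpace (v.adicCompletion (maximalRealSubfield L))] [BorelSpace (v.adicCompletion (maximalRealSubfield L))]
    (μ : Measure (v.adicCompletion (maximalRealSubfield L))) [μ.IsAddHaarMeasure]
    (hE : IsField (UnitaryGroup.LocalRing L v))
    {T₁ T₂ : Matrix (Fin 1) (Fin 1) (maximalRealSubfield L)} (hT₁ : T₁.IsSymm) (hT₂ : T₂.IsSymm) (hT₁d : IsUnit T₁.det) (hT₂d : IsUnit T₂.det)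
    (α : (maximalRealSubfield L)ˣ) (hTT' : T₂ = (α : maximalRealSubfield L) • T₁)
    (hclass : hilbertSymbol (v.adicCompletion (maximalRealSubfield L))
      ((-(α : maximalRealSubfield L)⁻¹ : maximalRealSubfield L) : v.adicCompletion (maximalRealSubfield L))
      ((imagUnitSq L : maximalRealSubfield L) : v.adicCompletion (maximalRealSubfield L)) = -1)
    {T : Matrix (Fin (1 + 1)) (Fin (1 + 1)) (maximalRealSubfield L)} (hT : T = UnitaryGroup.finSum 1 1 T₁ T₂) (hTs : T.IsSymm) (hTd : IsUnit T.det)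
    (χ : HeckeCharacter L) (hχ : IsSplittingChar L 1 χ)
    {JD₁ : Matrix (Fin (1 + 1)) (Fin (1 + 1)) L}
    (hJD₁ : JD₁ = (gramD (maximalRealSubfield L) 1 1).map (algebraMap (maximalRealSubfield L) L))
    (Λ : SchwartzBruhat (Fin (2 + 2) → v.adicCompletion (maximalRealSubfield L)) →ₗ[ℂ] ℂ),
    (∀ (g : UnitaryGroup.localPi L (IsCMField.complexConj L) (1 + 1) JD₁ v)
        (Ψ : SchwartzBruhat (Fin (2 + 2) → v.adicCompletion (maximalRealSubfield L))),
        Λ ((((localMu L χ v (Matrix.GeneralLinearGroup.det ((localPiEquiv L (IsCMField.complexConj L) (1 + 1) JD₁ v g).1)))⁻¹ : ℂˣ) : ℂ) •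
          MpPsi.toRep (localSchrodinger (maximalRealSubfield L) (2 + 2) (gramD (maximalRealSubfield L) 2 T) v)
            ((localSplittingDatumCM L v μ 2 hTs hTd rfl χ hχ).localSplitting
              (kronLoc (maximalRealSubfield L) L (IsCMField.complexConj L) v 2 (T := T) (J := T.map (algebraMap (maximalRealSubfield L) L))
                rfl rfl hJD₁ g)) Ψ) = Λ Ψ) →
    Λ = 0 := by
  intro L _ _ _ v _ _ μ _ hE T₁ T₂ hT₁ hT₂ hT₁d hT₂d α hTT' hclass T hT hTs hTd χ hχ JD₁ hJD₁ Λ hΛ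
  obtain ⟨Γ, c₀, n, w, A, κ, γ, m, hm, hc, hn, hA, hw⟩ := hOW L v μ hE hT₁ hT₂ hT₁d hT₂d α hTT' hclass hT hTs hTd χ hχ hJD₁
  exact functional_eq_zero_of_invariant_of_conjugate_model_fourierOp μ
    (isContinuousNontrivial_adeleAddCharAt (maximalRealSubfield L) v) hm
    (isLocallyConstant_of_isContinuousNontrivial (isContinuousNontrivial_adeleAddCharAt (maximalRealSubfield L) v))
    (Matrix.mulVecLin c₀) hc Γ
    (fun g => (((localMu L χ v (Matrix.GeneralLinearGroup.det ((localPiEquiv L (IsCMField.complexConj L) (1 + 1) JD₁ v g).1)))⁻¹ : ℂˣ) : ℂ) •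
              MpPsi.toRep (localSchrodinger (maximalRealSubfield L) (2 + 2) (gramD (maximalRealSubfield L) 2 T) v)
                ((localSplittingDatumCM L v μ 2 hTs hTd rfl χ hχ).localSplitting
                  (kronLoc (maximalRealSubfield L) L (IsCMField.complexConj L) v 2 (T := T) (J := T.map (algebraMap (maximalRealSubfield L) L))
                    rfl rfl hJD₁ g)))
    n hn w A κ hA γ hw Λ hΛ

end Summit.HodgeConjecture.HodgeConjecture.Cruxes.HLiu418.F0LD2SoftRoadJunction

end
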